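import Literature.NumberTheory.Sieve.CFSemigroupTwistedPhase
import HarnessLib

/-!
# The congruence transfer operator on the closed half-plane `Re s ≥ δ`

Support file (all results proved) for the named fact
`Literature.NumberTheory.Sieve.MageeOhWinter2019_uniformCounting` (`CFSemigroupCounting.lean`).
For the congruence transfer operator `𝓜_s = cfTwist A hA q s` of [MageeOhWinter2019, §3.2] on
`SL₂(ℤ/qℤ) → CfLip` (fixed `q`) we prove:

* the complex word sum `(𝓜_sⁿ F)_ξ(x) = Σ_{|w|=n} wt_s(M_w, x) F_{ξσ_w}(M_w x)` (`cfTwistSum_eq_sum`),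
  the norm bound `‖𝓜_sⁿ‖ ≤ 4^σ λ_σ^{2n} (2 + 8‖s‖e^{8‖s‖})` (`norm_cfTwist_pow_le_gen`, `σ = Re s ≥ δ`)
  and hence `1 - 𝓜_s` is a unit with Neumann inverse for `Re s > δ` (`isUnit_one_sub_cfTwist_of_lt`);
* **on the boundary line** `s = δ + it`, `t ≠ 0`: `1 - 𝓜_s` is a unit (`isUnit_one_sub_cfTwist_boundary`,
  for primitive twists) — Fredholm alternative for the frozen finite-rank part (as in
  `CFSemigroupBoundary.lean`) plus the eigenvalue exclusion `cfTwist_eigen_eq_zero`;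
* consequently `1 - 𝓜_s` is a unit on `{Re s ≥ δ} \ {δ}` and `s ↦ (1 - 𝓜_s)⁻¹` is continuous there
  (`continuousAt_inverse_one_sub_cfTwist`). [cite: MageeOhWinter2019, Lemma 15, §3.2]

## References

* M. Magee, H. Oh, D. Winter, J. reine angew. Math. 753 (2019) 89–135, §3.2, Lemma 15. [MageeOhWinter2019]
-/

noncomputable section

open Set Filter Topology
open scoped MatrixGroups

namespace Literature.NumberTheory.Sieve

variable {A : Finset ℕ}

section HalfPlane

variable (A) (hA : ∀ a ∈ A, 1 ≤ a) (h2 : 2 ≤ A.card) (q : ℕ)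
include hA

/-! ### Path weights at a general exponent -/

/-- The path weight at exponent `σ`: `((denom M_w x)²)^{-σ}`. [folklore] -/
def cfPathWtS (σ : ℝ) (w : List (A × A)) (x : ℝ) : ℝ := ((cfDenom (cfPathMat A w) x) ^ 2) ^ (-σ)

omit hA in
/-- Non-negativity. [folklore] -/
theorem cfPathWtS_nonneg (σ : ℝ) (w : List (A × A)) (x : ℝ) : 0 ≤ cfPathWtS A σ w x := Real.rpow_nonneg (sq_nonneg _) _

/-- Denominators of path matrices are `≥ 1` on `[0,1]`. [folklore] -/
theorem one_le_cfDenom_cfPathMat : ∀ (w : List (A × A)) {x : ℝ}, x ∈ Icc (0 : ℝ) 1 → 1 ≤ cfDenom (cfPathMat A w) x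
  | [], x, _ => by simp [cfPathMat, cfDenom]
  | p :: w, x, hx => by
      have hp := (cfDenom_pair_bounds (hA _ p.1.2) (hA _ p.2.2) hx).1
      have hy := cfMoeb_pair_mem (hA _ p.1.2) (hA _ p.2.2) hx
      rw [cfPathMat, cfDenom_mul _ _ (by linarith)]
      nlinarith [one_le_cfDenom_cfPathMat w hy]

/-- The path weight is `≤ 1` for `σ ≥ 0`. [folklore] -/
theorem cfPathWtS_le_one {σ : ℝ} (hσ : 0 ≤ σ) (w : List (A × A)) {x : ℝ} (hx : x ∈ Icc (0 : ℝ) 1) : cfPathWtS A σ w x ≤ 1 :=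
  Real.rpow_le_one_of_one_le_of_nonpos (by nlinarith [one_le_cfDenom_cfPathMat A hA w hx]) (by linarith)

/-- **The cocycle for path weights:** `wt_σ(p :: w, x) = ((d_p x)²)^{-σ} wt_σ(w, g_p x)`. [folklore] -/
theorem cfPathWtS_cons (σ : ℝ) (p : A × A) (w : List (A × A)) {x : ℝ} (hx : x ∈ Icc (0 : ℝ) 1) :
    cfPathWtS A σ (p :: w) x = ((cfDenom (cfGen ((p.1 : A) : ℕ) * cfGen ((p.2 : A) : ℕ)) x) ^ 2) ^ (-σ) *
      cfPathWtS A σ w (cfMoeb (cfGen ((p.1 : A) : ℕ) * cfGen ((p.2 : A) : ℕ)) x) := by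
  have hp := (cfDenom_pair_bounds (hA _ p.1.2) (hA _ p.2.2) hx).1
  rw [cfPathWtS, cfPathWtS, cfPathMat, cfDenom_mul _ _ (by linarith), mul_pow, Real.mul_rpow (sq_nonneg _) (sq_nonneg _)]

/-- The modulus of the complex path weight: `‖wt_s(M_w, x)‖ = wt_{Re s}(w, x)`. [folklore] -/
theorem norm_cfWt_cfPathMat (s : ℂ) (w : List (A × A)) {x : ℝ} (hx : x ∈ Icc (0 : ℝ) 1) :
    ‖cfWt s (cfPathMat A w) x‖ = cfPathWtS A s.re w x := by
  rw [norm_cfWt _ _ (by linarith [one_le_cfDenom_cfPathMat A hA w hx]), cfPathWtS]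

/-- The `δ`-path weight of `CFSemigroupTwistedPowers` is `wt_δ`. [folklore] -/
theorem cfPathWt_eq_cfPathWtS : ∀ (w : List (A × A)) {x : ℝ}, x ∈ Icc (0 : ℝ) 1 → cfPathWt A w x = cfPathWtS A (cfDimension A) w x
  | [], x, _ => by simp [cfPathWt, cfPathWtS, cfPathMat, cfDenom]
  | p :: w, x, hx => by
      rw [cfPathWt, cfPathWtS_cons A hA _ p w hx, cfPathWt_eq_cfPathWtS w (cfMoeb_pair_mem (hA _ p.1.2) (hA _ p.2.2) hx), cfWtR]

/-- **The total path weight is a transfer-operator iterate:** `Σ_{|w|=n} wt_σ(w, x) G(pt_w x) = (L_σ^{2n} G)(x)`.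
[cite: MageeOhWinter2019, §3.2] -/
theorem sum_cfPathWtS_mul (σ : ℝ) (G : ℝ → ℝ) :
    ∀ (n : ℕ) {x : ℝ}, x ∈ Icc (0 : ℝ) 1 →
      ∑ w : Fin n → A × A, cfPathWtS A σ (List.ofFn w) x * G (cfPathPoint A (List.ofFn w) x) = (cfTransfer A σ)^[2 * n] G x
  | 0, x, _ => by simp [cfPathWtS, cfPathMat, cfPathPoint, cfDenom]
  | n + 1, x, hx => by
      rw [show 2 * (n + 1) = 2 * n + 1 + 1 by ring, Function.iterate_succ_apply', Function.iterate_succ_apply',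
        ← (Fin.consEquiv fun _ => (A × A)).sum_comp, Fintype.sum_prod_type]
      simp only [Fin.consEquiv_apply, List.ofFn_succ, Fin.cons_zero, Fin.cons_succ]
      -- inner sums: `Σ_w wt(p :: w) G(pt) = ((d_p x)²)^{-σ} (L^{2n} G)(g_p x)`
      have hinner : ∀ p : A × A, ∑ w : Fin n → A × A, cfPathWtS A σ (p :: List.ofFn w) x * G (cfPathPoint A (p :: List.ofFn w) x) =
          ((cfDenom (cfGen ((p.1 : A) : ℕ) * cfGen ((p.2 : A) : ℕ)) x) ^ 2) ^ (-σ) *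
            (cfTransfer A σ)^[2 * n] G (cfMoeb (cfGen ((p.1 : A) : ℕ) * cfGen ((p.2 : A) : ℕ)) x) := by
        intro p
        have hy := cfMoeb_pair_mem (hA _ p.1.2) (hA _ p.2.2) hx
        rw [← sum_cfPathWtS_mul σ G n hy, Finset.mul_sum]
        refine Finset.sum_congr rfl fun w _ => ?_
        rw [cfPathWtS_cons A hA σ p _ hx, cfPathPoint, mul_assoc]
      rw [Finset.sum_congr rfl fun p _ => hinner p]
      -- `Σ_{(a,b)} ((d_{ab} x)²)^{-σ} H(g_a g_b x) = (L_σ (L_σ H))(x)`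
      set H := (cfTransfer A σ)^[2 * n] G
      rw [← sum_attach_attach_eq_sum_prod' A (fun a b => ((cfDenom (cfGen (a : ℕ) * cfGen (b : ℕ)) x) ^ 2) ^ (-σ) *
        H (cfMoeb (cfGen (a : ℕ) * cfGen (b : ℕ)) x)), cfTransfer, Finset.sum_comm, ← Finset.sum_attach A]
      refine Finset.sum_congr rfl fun b _ => ?_
      rw [cfTransfer, Finset.mul_sum, ← Finset.sum_attach A]
      refine Finset.sum_congr rfl fun a _ => ?_
      have hb1 : (1 : ℝ) ≤ ((b : ℕ) : ℝ) := by exact_mod_cast hA b b.2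
      have ha1 : (1 : ℝ) ≤ ((a : ℕ) : ℝ) := by exact_mod_cast hA a a.2
      have hxb : 0 < cfDenom (cfGen (b : ℕ)) x := by rw [cfDenom_cfGen]; linarith [hx.1]
      have hy : cfMoeb (cfGen (b : ℕ)) x ∈ Icc (0 : ℝ) 1 := by rw [cfMoeb_cfGen]; exact one_div_add_mem_Icc (hA b b.2) hx
      rw [cfDenom_mul _ _ hxb.ne', cfMoeb_mul _ _ hxb.ne' (by rw [cfDenom_cfGen]; linarith [hy.1]),
        cfDenom_cfGen, cfDenom_cfGen, cfMoeb_cfGen, cfMoeb_cfGen, mul_pow, Real.mul_rpow (sq_nonneg _) (sq_nonneg _)]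
      ring

/-- **Total path weight bound:** `Σ_{|w|=n} wt_σ(w, x) ≤ 4^σ λ_σ^{2n}` (`σ ≥ 0`). [cite: MageeOhWinter2019, §3.2] -/
theorem sum_cfPathWtS_le {σ : ℝ} (hσ : 0 ≤ σ) (hne : A.Nonempty) (n : ℕ) {x : ℝ} (hx : x ∈ Icc (0 : ℝ) 1) :
    ∑ w : Fin n → A × A, cfPathWtS A σ (List.ofFn w) x ≤ (4 : ℝ) ^ σ * cfEig A σ ^ (2 * n) := by
  have h := sum_cfPathWtS_mul A hA σ (fun _ => 1) n hx
  simp only [mul_one] at h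
  rw [h]
  have h2' := (cfTransfer_iterate_one_div_mem hA hne hσ (2 * n) hx).2
  rwa [div_le_iff₀ (pow_pos (cfEig_pos _) _)] at h2'

/-! ### Regularity of the complex path weights -/

include h2 in
/-- **Log-denominators along paths are `2`-Lipschitz** on `[0,1]`. [cite: MageeOhWinter2019, §2.1] -/
theorem abs_log_cfDenom_cfPathMat_sub_le (w : List (A × A)) {x y : ℝ} (hx : x ∈ Icc (0 : ℝ) 1) (hy : y ∈ Icc (0 : ℝ) 1) :
    |Real.log (cfDenom (cfPathMat A w) x) - Real.log (cfDenom (cfPathMat A w) y)| ≤ 2 * |x - y| := by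
  have hδ := cfDimension_pos hA h2
  have hDx : 0 < cfDenom (cfPathMat A w) x := by linarith [one_le_cfDenom_cfPathMat A hA w hx]
  have hDy : 0 < cfDenom (cfPathMat A w) y := by linarith [one_le_cfDenom_cfPathMat A hA w hy]
  -- `wt_δ(x) ≤ e^{4δ|x-y|} wt_δ(y)` and symmetrically, in logarithms
  have key : ∀ {u v : ℝ}, u ∈ Icc (0 : ℝ) 1 → v ∈ Icc (0 : ℝ) 1 →
      Real.log (cfDenom (cfPathMat A w) v) - Real.log (cfDenom (cfPathMat A w) u) ≤ 2 * |u - v| := by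
    intro u v hu hv
    have hDu : 0 < cfDenom (cfPathMat A w) u := by linarith [one_le_cfDenom_cfPathMat A hA w hu]
    have hDv : 0 < cfDenom (cfPathMat A w) v := by linarith [one_le_cfDenom_cfPathMat A hA w hv]
    have h1 := cfPathWt_le_exp_mul A hA h2 w hu hv
    rw [cfPathWt_eq_cfPathWtS A hA w hu, cfPathWt_eq_cfPathWtS A hA w hv, cfPathWtS, cfPathWtS,
      Real.rpow_def_of_pos (pow_pos hDu 2), Real.rpow_def_of_pos (pow_pos hDv 2), ← Real.exp_add, Real.exp_le_exp,
      Real.log_pow, Real.log_pow] at h1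
    push_cast at h1
    nlinarith [abs_nonneg (u - v)]
  have k1 := key hx hy
  have k2 := key hy hx
  rw [abs_sub_comm y x] at k2
  rw [abs_le]; constructor <;> linarith

include h2 in
/-- **Lipschitz variation of the complex path weights:**
`‖wt_s(M_w,x) - wt_s(M_w,y)‖ ≤ wt_{Re s}(w,y) · 4‖s‖ e^{4‖s‖|x-y|} |x-y|`. [cite: MageeOhWinter2019, §2.1] -/
theorem norm_cfWt_cfPathMat_sub_le (s : ℂ) (w : List (A × A)) {x y : ℝ} (hx : x ∈ Icc (0 : ℝ) 1) (hy : y ∈ Icc (0 : ℝ) 1) :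
    ‖cfWt s (cfPathMat A w) x - cfWt s (cfPathMat A w) y‖ ≤
      cfPathWtS A s.re w y * (4 * ‖s‖ * Real.exp (4 * ‖s‖ * |x - y|) * |x - y|) := by
  have hDy : 0 < cfDenom (cfPathMat A w) y := by linarith [one_le_cfDenom_cfPathMat A hA w hy]
  have hlog := abs_log_cfDenom_cfPathMat_sub_le A hA h2 w hx hy
  set Δ : ℝ := Real.log (cfDenom (cfPathMat A w) x) - Real.log (cfDenom (cfPathMat A w) y) with hΔ
  have hfac : cfWt s (cfPathMat A w) x - cfWt s (cfPathMat A w) y =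
      cfWt s (cfPathMat A w) y * (Complex.exp (-(2 * s * (Δ : ℂ))) - 1) := by
    rw [mul_sub, mul_one, cfWt, cfWt, ← Complex.exp_add]
    congr 2
    rw [hΔ]; push_cast; ring
  rw [hfac, norm_mul, norm_cfWt_cfPathMat A hA s w hy]
  refine mul_le_mul_of_nonneg_left ?_ (cfPathWtS_nonneg A _ _ _)
  have hz : ‖(-(2 * s * (Δ : ℂ)))‖ = 2 * ‖s‖ * |Δ| := by
    rw [norm_neg, norm_mul, norm_mul, Complex.norm_real, Real.norm_eq_abs]; norm_num
  have hbd : ‖Complex.exp (-(2 * s * (Δ : ℂ))) - 1‖ ≤ ‖(-(2 * s * (Δ : ℂ)))‖ * Real.exp ‖(-(2 * s * (Δ : ℂ)))‖ := by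
    have h := Complex.norm_exp_sub_sum_le_norm_mul_exp (-(2 * s * (Δ : ℂ))) 1
    simp only [Finset.range_one, Finset.sum_singleton, pow_zero, Nat.factorial_zero, Nat.cast_one, div_one, pow_one] at h
    exact h
  refine hbd.trans ?_
  rw [hz]
  have hs0 : 0 ≤ 2 * ‖s‖ := by positivity
  have h2Δ : 2 * ‖s‖ * |Δ| ≤ 4 * ‖s‖ * |x - y| := by nlinarith [norm_nonneg s]
  have hexp : Real.exp (2 * ‖s‖ * |Δ|) ≤ Real.exp (4 * ‖s‖ * |x - y|) := Real.exp_le_exp.2 h2Δ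
  calc 2 * ‖s‖ * |Δ| * Real.exp (2 * ‖s‖ * |Δ|) ≤ 4 * ‖s‖ * |x - y| * Real.exp (4 * ‖s‖ * |x - y|) :=
        mul_le_mul h2Δ hexp (Real.exp_pos _).le (by positivity)
    _ = _ := by ring

/-! ### The complex word sum and norm bounds for the powers -/

/-- **The complex word sum:** `T_n F ξ x = Σ_{|w|=n} wt_s(M_w, x) F_{ξσ_w}(pt_w x)` on `[0,1]`. [cite: MageeOhWinter2019, §3.2] -/
theorem cfTwistSum_eq_sum (s : ℂ) :
    ∀ (n : ℕ) (F : SL(2, ZMod q) → CfLip) (ξ : SL(2, ZMod q)) {x : ℝ}, x ∈ Icc (0 : ℝ) 1 →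
      cfTwistSum A q s n F ξ x = ∑ w : Fin n → A × A,
        cfWt s (cfPathMat A (List.ofFn w)) x * (F (ξ * cfSigmaWord A q (List.ofFn w))).extend (cfPathPoint A (List.ofFn w) x)
  | 0, F, ξ, x, _ => by simp [cfTwistSum, cfPathMat, cfPathPoint, cfWt, cfDenom]
  | n + 1, F, ξ, x, hx => by
      rw [cfTwistSum, ← (Fin.consEquiv fun _ => (A × A)).sum_comp, Fintype.sum_prod_type, sum_attach_attach_eq_sum_prod']
      refine Finset.sum_congr rfl fun p _ => ?_
      obtain ⟨a, b⟩ := p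
      have hy := cfMoeb_pair_mem (hA a a.2) (hA b b.2) hx
      rw [cfTwistSum_eq_sum s n F _ hy, Finset.mul_sum]
      refine Finset.sum_congr rfl fun w _ => ?_
      simp only [Fin.consEquiv_apply, List.ofFn_succ, Fin.cons_zero, Fin.cons_succ, cfPathPoint, cfPathMat,
        show ∀ l : List (A × A), cfSigmaWord A q ((a, b) :: l) = cfSigma q (a : ℕ) (b : ℕ) * cfSigmaWord A q l from
          fun l => by rw [show (a, b) :: l = [(a, b)] ++ l from rfl, cfSigmaWord_append, cfSigmaWord_singleton], mul_assoc]
      have hp : 0 < cfDenom (cfGen (a : ℕ) * cfGen (b : ℕ)) x := by linarith [(cfDenom_pair_bounds (hA a a.2) (hA b b.2) hx).1]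
      have hM : 0 < cfDenom (cfPathMat A (List.ofFn w)) (cfMoeb (cfGen (a : ℕ) * cfGen (b : ℕ)) x) := by
        linarith [one_le_cfDenom_cfPathMat A hA (List.ofFn w) hy]
      rw [cfWt_mul _ _ _ hp hM, mul_assoc]

include h2 in
/-- **Sup and Lipschitz bounds for the powers at general `s`** (`Re s ≥ 0`):
`|(𝓜ⁿF)_ξ(x)| ≤ 4^σ λ_σ^{2n} ‖F‖` and
`|(𝓜ⁿF)_ξ(x) - (𝓜ⁿF)_ξ(y)| ≤ 4^σ λ_σ^{2n} (4‖s‖e^{4‖s‖} + 2^{-n}) ‖F‖ |x - y|`. [cite: MageeOhWinter2019, Lemma 15] -/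
theorem cfTwist_pow_apply_bounds_gen [NeZero q] {s : ℂ} (hs : 0 ≤ s.re) (n : ℕ) (F : SL(2, ZMod q) → CfLip) (ξ : SL(2, ZMod q)) :
    (∀ x : Icc (0 : ℝ) 1, ‖(cfTwist A hA q s ^ n) F ξ x‖ ≤ (4 : ℝ) ^ s.re * cfEig A s.re ^ (2 * n) * ‖F‖) ∧
      ∀ x y : Icc (0 : ℝ) 1, ‖(cfTwist A hA q s ^ n) F ξ x - (cfTwist A hA q s ^ n) F ξ y‖ ≤
        (4 : ℝ) ^ s.re * cfEig A s.re ^ (2 * n) * (4 * ‖s‖ * Real.exp (4 * ‖s‖) + (1 / 2 : ℝ) ^ n) * ‖F‖ * |(x : ℝ) - y| := by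
  have hne := nonempty_of_two_le_card h2
  have hF := norm_nonneg F
  have hFη : ∀ η, ‖F η‖ ≤ ‖F‖ := fun η => norm_le_pi_norm F η
  have hval : ∀ x : Icc (0 : ℝ) 1, (cfTwist A hA q s ^ n) F ξ x = ∑ w : Fin n → A × A,
      cfWt s (cfPathMat A (List.ofFn w)) x * (F (ξ * cfSigmaWord A q (List.ofFn w))).extend (cfPathPoint A (List.ofFn w) x) :=
    fun x => by rw [cfTwist_pow_apply, cfTwistSum_eq_sum A hA q s n F ξ x.2]
  refine ⟨fun x => ?_, fun x y => ?_⟩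
  · rw [hval]
    refine (norm_sum_le _ _).trans ?_
    have hterm : ∀ w : Fin n → A × A, ‖cfWt s (cfPathMat A (List.ofFn w)) x *
        (F (ξ * cfSigmaWord A q (List.ofFn w))).extend (cfPathPoint A (List.ofFn w) x)‖ ≤ cfPathWtS A s.re (List.ofFn w) x * ‖F‖ := by
      intro w
      rw [norm_mul, norm_cfWt_cfPathMat A hA s _ x.2]
      exact mul_le_mul_of_nonneg_left (((F _).norm_extend_le _).trans (hFη _)) (cfPathWtS_nonneg A _ _ _)
    refine (Finset.sum_le_sum fun w _ => hterm w).trans ?_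
    rw [← Finset.sum_mul]
    exact mul_le_mul_of_nonneg_right (sum_cfPathWtS_le A hA hs hne n x.2) hF
  · rw [hval, hval, ← Finset.sum_sub_distrib]
    refine (norm_sum_le _ _).trans ?_
    set c := 4 * ‖s‖ * Real.exp (4 * ‖s‖) with hc
    have hd1 : |(x : ℝ) - y| ≤ 1 := by rw [abs_le]; constructor <;> linarith [x.2.1, x.2.2, y.2.1, y.2.2]
    have hterm : ∀ w : Fin n → A × A,
        ‖cfWt s (cfPathMat A (List.ofFn w)) x * (F (ξ * cfSigmaWord A q (List.ofFn w))).extend (cfPathPoint A (List.ofFn w) x) -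
          cfWt s (cfPathMat A (List.ofFn w)) y * (F (ξ * cfSigmaWord A q (List.ofFn w))).extend (cfPathPoint A (List.ofFn w) y)‖ ≤
        cfPathWtS A s.re (List.ofFn w) y * ((c + (1 / 2 : ℝ) ^ n) * ‖F‖ * |(x : ℝ) - y|) := by
      intro w
      set l := List.ofFn w
      set G := F (ξ * cfSigmaWord A q l)
      have hlen : l.length = n := by simp [l]
      have h1 := norm_cfWt_cfPathMat_sub_le A hA h2 s l x.2 y.2
      have h2' := abs_cfPathPoint_sub_le A hA l x.2 y.2
      rw [hlen] at h2'
      have hGx : ‖G.extend (cfPathPoint A l x)‖ ≤ ‖F‖ := (G.norm_extend_le _).trans (hFη _)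
      have hGd : ‖G.extend (cfPathPoint A l x) - G.extend (cfPathPoint A l y)‖ ≤ ‖F‖ * ((1 / 2 : ℝ) ^ n * |(x : ℝ) - y|) :=
        (G.norm_extend_sub_le (cfPathPoint_mem A hA l x.2) (cfPathPoint_mem A hA l y.2)).trans
          (mul_le_mul (hFη _) h2' (abs_nonneg _) hF)
      have e : cfWt s (cfPathMat A l) x * G.extend (cfPathPoint A l x) - cfWt s (cfPathMat A l) y * G.extend (cfPathPoint A l y) =
          (cfWt s (cfPathMat A l) x - cfWt s (cfPathMat A l) y) * G.extend (cfPathPoint A l x) +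
            cfWt s (cfPathMat A l) y * (G.extend (cfPathPoint A l x) - G.extend (cfPathPoint A l y)) := by ring
      rw [e]
      refine (norm_add_le _ _).trans ?_
      rw [norm_mul, norm_mul, norm_cfWt_cfPathMat A hA s l y.2]
      have hexp : Real.exp (4 * ‖s‖ * |(x : ℝ) - y|) ≤ Real.exp (4 * ‖s‖) := Real.exp_le_exp.2 (by nlinarith [norm_nonneg s, abs_nonneg ((x:ℝ) - y)])
      have hw0 := cfPathWtS_nonneg A s.re l y
      have t1 : ‖cfWt s (cfPathMat A l) x - cfWt s (cfPathMat A l) y‖ * ‖G.extend (cfPathPoint A l x)‖ ≤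
          cfPathWtS A s.re l y * (c * |(x : ℝ) - y|) * ‖F‖ := by
        refine mul_le_mul (h1.trans ?_) hGx (norm_nonneg _) (by positivity)
        rw [hc]
        refine mul_le_mul_of_nonneg_left ?_ hw0
        exact mul_le_mul_of_nonneg_right (mul_le_mul_of_nonneg_left hexp (by positivity)) (abs_nonneg _)
      have t2 : cfPathWtS A s.re l y * ‖G.extend (cfPathPoint A l x) - G.extend (cfPathPoint A l y)‖ ≤
          cfPathWtS A s.re l y * (‖F‖ * ((1 / 2 : ℝ) ^ n * |(x : ℝ) - y|)) := mul_le_mul_of_nonneg_left hGd hw0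
      nlinarith [t1, t2]
    refine (Finset.sum_le_sum fun w _ => hterm w).trans ?_
    rw [← Finset.sum_mul]
    have hs4 := sum_cfPathWtS_le A hA hs hne n y.2
    have hpos : 0 ≤ (c + (1 / 2 : ℝ) ^ n) * ‖F‖ * |(x : ℝ) - y| := by positivity
    calc (∑ w : Fin n → A × A, cfPathWtS A s.re (List.ofFn w) y) * ((c + (1 / 2 : ℝ) ^ n) * ‖F‖ * |(x : ℝ) - y|)
        ≤ ((4 : ℝ) ^ s.re * cfEig A s.re ^ (2 * n)) * ((c + (1 / 2 : ℝ) ^ n) * ‖F‖ * |(x : ℝ) - y|) :=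
          mul_le_mul_of_nonneg_right hs4 hpos
      _ = _ := by ring

include h2 in
/-- **Operator norm of the powers at general `s`:** `‖𝓜_sⁿ‖ ≤ 4^σ λ_σ^{2n} (2 + 4‖s‖e^{4‖s‖})`.
[cite: MageeOhWinter2019, Lemma 15] -/
theorem norm_cfTwist_pow_le_gen [NeZero q] {s : ℂ} (hs : 0 ≤ s.re) (n : ℕ) :
    ‖cfTwist A hA q s ^ n‖ ≤ (4 : ℝ) ^ s.re * cfEig A s.re ^ (2 * n) * (2 + 4 * ‖s‖ * Real.exp (4 * ‖s‖)) := by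
  have hlam := cfEig_pos (A := A) s.re
  refine ContinuousLinearMap.opNorm_le_bound _ (by positivity) fun F => ?_
  have hR : 0 ≤ (4 : ℝ) ^ s.re * cfEig A s.re ^ (2 * n) * (2 + 4 * ‖s‖ * Real.exp (4 * ‖s‖)) * ‖F‖ := by positivity
  rw [pi_norm_le_iff_of_nonneg hR]
  intro ξ
  obtain ⟨hsup, hlip⟩ := cfTwist_pow_apply_bounds_gen A hA h2 q hs n F ξ
  have hLc : 0 ≤ (4 : ℝ) ^ s.re * cfEig A s.re ^ (2 * n) * (4 * ‖s‖ * Real.exp (4 * ‖s‖) + (1 / 2 : ℝ) ^ n) * ‖F‖ := by positivity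
  refine (CfLip.norm_le_of_bounds hLc hsup hlip).trans ?_
  have hhalf : (1 / 2 : ℝ) ^ n ≤ 1 := pow_le_one₀ (by norm_num) (by norm_num)
  have hF := norm_nonneg F
  have h4 : 0 ≤ (4 : ℝ) ^ s.re * cfEig A s.re ^ (2 * n) * ‖F‖ := by positivity
  nlinarith

include h2 in
/-- **`1 - 𝓜_s` is a unit for `Re s > δ`** (summable Neumann series). [cite: MageeOhWinter2019, Lemma 15] -/
theorem isUnit_one_sub_cfTwist_of_lt [NeZero q] {s : ℂ} (hs : cfDimension A < s.re) :
    (Summable fun n => ‖cfTwist A hA q s ^ n‖) ∧ IsUnit (1 - cfTwist A hA q s) := by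
  have hδ := (cfDimension_pos hA h2).le
  have hs0 : 0 ≤ s.re := by linarith
  have hlam := cfEig_pos (A := A) s.re
  have hlam1 := cfEig_lt_one_of_lt A hA h2 hs
  have hsum : Summable fun n => ‖cfTwist A hA q s ^ n‖ := by
    refine Summable.of_nonneg_of_le (fun n => norm_nonneg _) (norm_cfTwist_pow_le_gen A hA h2 q hs0) ?_
    have hg : Summable fun n : ℕ => (cfEig A s.re ^ 2) ^ n := summable_geometric_of_lt_one (by positivity) (by nlinarith)
    have := (hg.mul_left ((4 : ℝ) ^ s.re)).mul_right (2 + 4 * ‖s‖ * Real.exp (4 * ‖s‖))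
    refine this.congr fun n => ?_
    rw [← pow_mul]
  exact ⟨hsum, isUnit_one_sub_of_summable_norm_pow hsum⟩

/-! ### The frozen finite-rank part at `s = δ + it` -/

include h2 in
/-- **The complex path weight as an element of `CfLip`** at `Re s = δ`: `x ↦ wt_s(M_w, x)`, with Lipschitz
constant `4‖s‖e^{4‖s‖}`. [folklore] -/
def cfPathWtLip {s : ℂ} (hs : s.re = cfDimension A) {N : ℕ} (w : Fin N → A × A) : CfLip :=
  CfLip.mk' (fun x => cfWt s (cfPathMat A (List.ofFn w)) x) (4 * ‖s‖ * Real.exp (4 * ‖s‖)) fun x y => by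
    refine (norm_cfWt_cfPathMat_sub_le A hA h2 s (List.ofFn w) x.2 y.2).trans ?_
    have hd1 : |(x : ℝ) - y| ≤ 1 := by rw [abs_le]; constructor <;> linarith [x.2.1, x.2.2, y.2.1, y.2.2]
    have hexp : Real.exp (4 * ‖s‖ * |(x : ℝ) - y|) ≤ Real.exp (4 * ‖s‖) :=
      Real.exp_le_exp.2 (by nlinarith [norm_nonneg s, abs_nonneg ((x : ℝ) - y)])
    have hwt : cfPathWtS A s.re (List.ofFn w) y ≤ 1 := by
      rw [hs]; exact cfPathWtS_le_one A hA (cfDimension_pos hA h2).le _ y.2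
    have h0 := cfPathWtS_nonneg A s.re (List.ofFn w) y
    calc cfPathWtS A s.re (List.ofFn w) y * (4 * ‖s‖ * Real.exp (4 * ‖s‖ * |(x : ℝ) - y|) * |(x : ℝ) - y|)
        ≤ 1 * (4 * ‖s‖ * Real.exp (4 * ‖s‖) * |(x : ℝ) - y|) := by
          refine mul_le_mul hwt ?_ (by positivity) zero_le_one
          exact mul_le_mul_of_nonneg_right (mul_le_mul_of_nonneg_left hexp (by positivity)) (abs_nonneg _)
      _ = _ := by ring

include h2 in
/-- Evaluation of `cfPathWtLip`. [folklore] -/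
@[simp] theorem cfPathWtLip_apply {s : ℂ} (hs : s.re = cfDimension A) {N : ℕ} (w : Fin N → A × A) (x : Icc (0 : ℝ) 1) :
    cfPathWtLip A hA h2 hs w x = cfWt s (cfPathMat A (List.ofFn w)) x := rfl

/-- The base points `pt_w(0) ∈ [0,1]`. [folklore] -/
def cfPathBase {N : ℕ} (w : Fin N → A × A) : Icc (0 : ℝ) 1 :=
  ⟨cfPathPoint A (List.ofFn w) 0, cfPathPoint_mem A hA _ (Set.left_mem_Icc.2 zero_le_one)⟩

include h2 in
/-- **The frozen operator** `(K_N F)_ξ = Σ_{|w|=N} F_{ξσ_w}(pt_w 0) · wt_s(M_w, ·)` (finite rank).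
[folklore] -/
def cfTwK [NeZero q] {s : ℂ} (hs : s.re = cfDimension A) (N : ℕ) : (SL(2, ZMod q) → CfLip) →L[ℂ] (SL(2, ZMod q) → CfLip) :=
  ContinuousLinearMap.pi fun ξ => ∑ w : Fin N → A × A,
    ((CfLip.eval (cfPathBase A hA w)).comp (ContinuousLinearMap.proj (ξ * cfSigmaWord A q (List.ofFn w)))).smulRight
      (cfPathWtLip A hA h2 hs w)

include h2 in
/-- Pointwise formula for `K_N`. [folklore] -/
theorem cfTwK_apply [NeZero q] {s : ℂ} (hs : s.re = cfDimension A) (N : ℕ) (F : SL(2, ZMod q) → CfLip)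
    (ξ : SL(2, ZMod q)) (x : Icc (0 : ℝ) 1) :
    cfTwK A hA h2 q hs N F ξ x = ∑ w : Fin N → A × A,
      cfWt s (cfPathMat A (List.ofFn w)) x * (F (ξ * cfSigmaWord A q (List.ofFn w))).extend (cfPathPoint A (List.ofFn w) 0) := by
  simp only [cfTwK, ContinuousLinearMap.pi_apply, _root_.sum_apply, CfLip.finset_sum_apply]
  refine Finset.sum_congr rfl fun w _ => ?_
  rw [ContinuousLinearMap.smulRight_apply, CfLip.smul_apply, ContinuousLinearMap.coe_comp, Function.comp_apply,
    ContinuousLinearMap.proj_apply, CfLip.eval_apply, cfPathWtLip_apply, mul_comm]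
  congr 1
  exact (CfLip.extend_of_mem _ (cfPathPoint_mem A hA _ (Set.left_mem_Icc.2 zero_le_one))).symm

include h2 in
/-- **`K_N` has finite rank:** its range lies in the span of the finitely many `ι_ξ(wt_s(M_w, ·))`. [folklore] -/
theorem cfTwK_finiteDimensional [NeZero q] {s : ℂ} (hs : s.re = cfDimension A) (N : ℕ) :
    FiniteDimensional ℂ (LinearMap.range (cfTwK A hA h2 q hs N : (SL(2, ZMod q) → CfLip) →ₗ[ℂ] (SL(2, ZMod q) → CfLip))) := by
  set S : Set (SL(2, ZMod q) → CfLip) := Set.range fun p : SL(2, ZMod q) × (Fin N → A × A) => cfTwSingle q p.1 (cfPathWtLip A hA h2 hs p.2)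
  haveI : FiniteDimensional ℂ (Submodule.span ℂ S) := FiniteDimensional.span_of_finite ℂ (Set.finite_range _)
  suffices hle : LinearMap.range (cfTwK A hA h2 q hs N : (SL(2, ZMod q) → CfLip) →ₗ[ℂ] (SL(2, ZMod q) → CfLip)) ≤ Submodule.span ℂ S from
    Submodule.finiteDimensional_of_le hle
  rintro G ⟨F, rfl⟩
  show cfTwK A hA h2 q hs N F ∈ Submodule.span ℂ S
  -- `K F = Σ_ξ Σ_w c_{ξ,w} • ι_ξ (wt_w)`
  have hrep : cfTwK A hA h2 q hs N F = ∑ ξ : SL(2, ZMod q), ∑ w : Fin N → A × A,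
      (F (ξ * cfSigmaWord A q (List.ofFn w))).extend (cfPathPoint A (List.ofFn w) 0) • cfTwSingle q ξ (cfPathWtLip A hA h2 hs w) := by
    funext η
    refine DFunLike.ext _ _ fun x => ?_
    rw [cfTwK_apply]
    simp only [Finset.sum_apply, Pi.smul_apply, cfTwSingle_apply, CfLip.finset_sum_apply, CfLip.smul_apply]
    rw [Finset.sum_eq_single η (fun ξ _ hne => by simp [Ne.symm hne]) (fun h => absurd (Finset.mem_univ η) h)]
    simp only [if_true, cfPathWtLip_apply]
    exact Finset.sum_congr rfl fun w _ => mul_comm _ _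
  rw [hrep]
  refine Submodule.sum_mem _ fun ξ _ => Submodule.sum_mem _ fun w _ => Submodule.smul_mem _ _ (Submodule.subset_span ⟨(ξ, w), rfl⟩)

include h2 in
/-- **The remainder `S_N = 𝓜_sᴺ - K_N` is small:** `‖S_N‖ ≤ 4^δ 2^{-N} (2 + 4‖s‖e^{4‖s‖})` at `Re s = δ`.
[folklore] -/
theorem norm_cfTwist_pow_sub_cfTwK_le [NeZero q] {s : ℂ} (hs : s.re = cfDimension A) (N : ℕ) :
    ‖cfTwist A hA q s ^ N - cfTwK A hA h2 q hs N‖ ≤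
      (4 : ℝ) ^ cfDimension A * (1 / 2 : ℝ) ^ N * (2 + 4 * ‖s‖ * Real.exp (4 * ‖s‖)) := by
  have hδ := (cfDimension_pos hA h2).le
  have hne := nonempty_of_two_le_card h2
  set c := 4 * ‖s‖ * Real.exp (4 * ‖s‖) with hc
  refine ContinuousLinearMap.opNorm_le_bound _ (by positivity) fun F => ?_
  have hF := norm_nonneg F
  have hFη : ∀ η, ‖F η‖ ≤ ‖F‖ := fun η => norm_le_pi_norm F η
  have hR : 0 ≤ (4 : ℝ) ^ cfDimension A * (1 / 2 : ℝ) ^ N * (2 + c) * ‖F‖ := by positivity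
  rw [pi_norm_le_iff_of_nonneg hR]
  intro ξ
  -- pointwise formula
  have hval : ∀ x : Icc (0 : ℝ) 1, (cfTwist A hA q s ^ N - cfTwK A hA h2 q hs N) F ξ x = ∑ w : Fin N → A × A,
      cfWt s (cfPathMat A (List.ofFn w)) x * ((F (ξ * cfSigmaWord A q (List.ofFn w))).extend (cfPathPoint A (List.ofFn w) x) -
        (F (ξ * cfSigmaWord A q (List.ofFn w))).extend (cfPathPoint A (List.ofFn w) 0)) := by
    intro x
    show ((cfTwist A hA q s ^ N) F ξ - cfTwK A hA h2 q hs N F ξ) x = _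
    rw [CfLip.sub_apply, cfTwist_pow_apply, cfTwistSum_eq_sum A hA q s N F ξ x.2, cfTwK_apply, ← Finset.sum_sub_distrib]
    exact Finset.sum_congr rfl fun w _ => by ring
  -- per-word data
  have h0I : (0 : ℝ) ∈ Icc (0 : ℝ) 1 := Set.left_mem_Icc.2 zero_le_one
  have hcontr : ∀ (w : Fin N → A × A) (x : Icc (0 : ℝ) 1),
      ‖(F (ξ * cfSigmaWord A q (List.ofFn w))).extend (cfPathPoint A (List.ofFn w) x) -
        (F (ξ * cfSigmaWord A q (List.ofFn w))).extend (cfPathPoint A (List.ofFn w) 0)‖ ≤ ‖F‖ * (1 / 2 : ℝ) ^ N := by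
    intro w x
    refine ((F _).norm_extend_sub_le (cfPathPoint_mem A hA _ x.2) (cfPathPoint_mem A hA _ h0I)).trans ?_
    refine mul_le_mul (hFη _) ?_ (abs_nonneg _) hF
    have h := abs_cfPathPoint_sub_le A hA (List.ofFn w) x.2 h0I
    rw [List.length_ofFn] at h
    refine h.trans ?_
    have : |(x : ℝ) - 0| ≤ 1 := by rw [sub_zero, abs_of_nonneg x.2.1]; exact x.2.2
    calc (1 / 2 : ℝ) ^ N * |(x : ℝ) - 0| ≤ (1 / 2 : ℝ) ^ N * 1 := mul_le_mul_of_nonneg_left this (by positivity)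
      _ = _ := mul_one _
  have hsumwt : ∀ y : Icc (0 : ℝ) 1, ∑ w : Fin N → A × A, cfPathWtS A s.re (List.ofFn w) y ≤ (4 : ℝ) ^ cfDimension A := by
    intro y
    have h := sum_cfPathWtS_le A hA (σ := s.re) (by rw [hs]; exact hδ) hne N y.2
    rw [hs, cfEig_cfDimension hA h2, one_pow, mul_one] at h
    rw [hs]
    exact h
  -- sup bound
  have hsup : ∀ x : Icc (0 : ℝ) 1, ‖(cfTwist A hA q s ^ N - cfTwK A hA h2 q hs N) F ξ x‖ ≤ (4 : ℝ) ^ cfDimension A * (1 / 2 : ℝ) ^ N * ‖F‖ := by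
    intro x
    rw [hval]
    refine (norm_sum_le _ _).trans ?_
    have hterm : ∀ w : Fin N → A × A, ‖cfWt s (cfPathMat A (List.ofFn w)) x *
        ((F (ξ * cfSigmaWord A q (List.ofFn w))).extend (cfPathPoint A (List.ofFn w) x) -
          (F (ξ * cfSigmaWord A q (List.ofFn w))).extend (cfPathPoint A (List.ofFn w) 0))‖ ≤
        cfPathWtS A s.re (List.ofFn w) x * (‖F‖ * (1 / 2 : ℝ) ^ N) := fun w => by
      rw [norm_mul, norm_cfWt_cfPathMat A hA s _ x.2]
      exact mul_le_mul_of_nonneg_left (hcontr w x) (cfPathWtS_nonneg A _ _ _)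
    refine (Finset.sum_le_sum fun w _ => hterm w).trans ?_
    rw [← Finset.sum_mul]
    calc (∑ w : Fin N → A × A, cfPathWtS A s.re (List.ofFn w) x) * (‖F‖ * (1 / 2 : ℝ) ^ N)
        ≤ (4 : ℝ) ^ cfDimension A * (‖F‖ * (1 / 2 : ℝ) ^ N) := mul_le_mul_of_nonneg_right (hsumwt x) (by positivity)
      _ = _ := by ring
  -- Lipschitz bound
  have hlip : ∀ x y : Icc (0 : ℝ) 1, ‖(cfTwist A hA q s ^ N - cfTwK A hA h2 q hs N) F ξ x - (cfTwist A hA q s ^ N - cfTwK A hA h2 q hs N) F ξ y‖ ≤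
      (4 : ℝ) ^ cfDimension A * (1 / 2 : ℝ) ^ N * (c + 1) * ‖F‖ * |(x : ℝ) - y| := by
    intro x y
    rw [hval, hval, ← Finset.sum_sub_distrib]
    refine (norm_sum_le _ _).trans ?_
    have hd1 : |(x : ℝ) - y| ≤ 1 := by rw [abs_le]; constructor <;> linarith [x.2.1, x.2.2, y.2.1, y.2.2]
    have hterm : ∀ w : Fin N → A × A,
        ‖cfWt s (cfPathMat A (List.ofFn w)) x * ((F (ξ * cfSigmaWord A q (List.ofFn w))).extend (cfPathPoint A (List.ofFn w) x) -
            (F (ξ * cfSigmaWord A q (List.ofFn w))).extend (cfPathPoint A (List.ofFn w) 0)) -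
          cfWt s (cfPathMat A (List.ofFn w)) y * ((F (ξ * cfSigmaWord A q (List.ofFn w))).extend (cfPathPoint A (List.ofFn w) y) -
            (F (ξ * cfSigmaWord A q (List.ofFn w))).extend (cfPathPoint A (List.ofFn w) 0))‖ ≤
        cfPathWtS A s.re (List.ofFn w) y * ((c + 1) * ((1 / 2 : ℝ) ^ N * ‖F‖ * |(x : ℝ) - y|)) := by
      intro w
      set l := List.ofFn w
      set G := F (ξ * cfSigmaWord A q l)
      set Dx := G.extend (cfPathPoint A l x) - G.extend (cfPathPoint A l 0)
      set Dy := G.extend (cfPathPoint A l y) - G.extend (cfPathPoint A l 0)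
      have hlen : l.length = N := by simp [l]
      have h1 := norm_cfWt_cfPathMat_sub_le A hA h2 s l x.2 y.2
      have h2' := abs_cfPathPoint_sub_le A hA l x.2 y.2
      rw [hlen] at h2'
      have hDx : ‖Dx‖ ≤ ‖F‖ * (1 / 2 : ℝ) ^ N := hcontr w x
      have hDd : ‖Dx - Dy‖ ≤ ‖F‖ * ((1 / 2 : ℝ) ^ N * |(x : ℝ) - y|) := by
        have e : Dx - Dy = G.extend (cfPathPoint A l x) - G.extend (cfPathPoint A l y) := by simp only [Dx, Dy]; ring
        rw [e]
        exact (G.norm_extend_sub_le (cfPathPoint_mem A hA l x.2) (cfPathPoint_mem A hA l y.2)).trans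
          (mul_le_mul (hFη _) h2' (abs_nonneg _) hF)
      have e : cfWt s (cfPathMat A l) x * Dx - cfWt s (cfPathMat A l) y * Dy =
          (cfWt s (cfPathMat A l) x - cfWt s (cfPathMat A l) y) * Dx + cfWt s (cfPathMat A l) y * (Dx - Dy) := by ring
      rw [e]
      refine (norm_add_le _ _).trans ?_
      rw [norm_mul, norm_mul, norm_cfWt_cfPathMat A hA s l y.2]
      have hexp : Real.exp (4 * ‖s‖ * |(x : ℝ) - y|) ≤ Real.exp (4 * ‖s‖) := Real.exp_le_exp.2 (by nlinarith [norm_nonneg s, abs_nonneg ((x:ℝ) - y)])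
      have hw0 := cfPathWtS_nonneg A s.re l y
      have t1 : ‖cfWt s (cfPathMat A l) x - cfWt s (cfPathMat A l) y‖ * ‖Dx‖ ≤
          cfPathWtS A s.re l y * (c * |(x : ℝ) - y|) * (‖F‖ * (1 / 2 : ℝ) ^ N) := by
        refine mul_le_mul (h1.trans ?_) hDx (norm_nonneg _) (by positivity)
        rw [hc]
        refine mul_le_mul_of_nonneg_left ?_ hw0
        exact mul_le_mul_of_nonneg_right (mul_le_mul_of_nonneg_left hexp (by positivity)) (abs_nonneg _)
      have t2 : cfPathWtS A s.re l y * ‖Dx - Dy‖ ≤ cfPathWtS A s.re l y * (‖F‖ * ((1 / 2 : ℝ) ^ N * |(x : ℝ) - y|)) :=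
        mul_le_mul_of_nonneg_left hDd hw0
      nlinarith [t1, t2]
    refine (Finset.sum_le_sum fun w _ => hterm w).trans ?_
    rw [← Finset.sum_mul]
    have hpos : 0 ≤ (c + 1) * ((1 / 2 : ℝ) ^ N * ‖F‖ * |(x : ℝ) - y|) := by positivity
    calc (∑ w : Fin N → A × A, cfPathWtS A s.re (List.ofFn w) y) * ((c + 1) * ((1 / 2 : ℝ) ^ N * ‖F‖ * |(x : ℝ) - y|))
        ≤ (4 : ℝ) ^ cfDimension A * ((c + 1) * ((1 / 2 : ℝ) ^ N * ‖F‖ * |(x : ℝ) - y|)) := mul_le_mul_of_nonneg_right (hsumwt y) hpos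
      _ = _ := by ring
  have hLc : 0 ≤ (4 : ℝ) ^ cfDimension A * (1 / 2 : ℝ) ^ N * (c + 1) * ‖F‖ := by positivity
  refine (CfLip.norm_le_of_bounds hLc hsup hlip).trans (le_of_eq ?_)
  ring

/-! ### Units on the boundary line -/

include h2 in
/-- **Invertibility of `1 - 𝓜_{δ+it}` for `t ≠ 0`** (fixed `q`, primitive twists): Fredholm alternative
for the frozen finite-rank part plus the eigenvalue exclusion `cfTwist_eigen_eq_zero`
([MageeOhWinter2019, Lemma 15] for the congruence operator at level `q`). [cite: MageeOhWinter2019, Lemma 15] -/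
theorem isUnit_one_sub_cfTwist_boundary [NeZero q] {n₀ : ℕ}
    (hprim : ∀ n ≥ n₀, ∀ ξ η : SL(2, ZMod q), ∃ w : List (A × A), w.length = n ∧ ξ * cfSigmaWord A q w = η)
    {t : ℝ} (ht : t ≠ 0) : IsUnit (1 - cfTwist A hA q ((cfDimension A : ℂ) + t * Complex.I)) := by
  set s : ℂ := (cfDimension A : ℂ) + t * Complex.I with hsdef
  have hs : s.re = cfDimension A := by simp [hsdef]
  have hδ := (cfDimension_pos hA h2).le
  set T := cfTwist A hA q s with hT
  -- choose `N` with `‖S_N‖ < 1`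
  set C : ℝ := (4 : ℝ) ^ cfDimension A * (2 + 4 * ‖s‖ * Real.exp (4 * ‖s‖)) with hC
  have hC0 : 0 < C := by positivity
  obtain ⟨N, hN⟩ := exists_pow_lt_of_lt_one (inv_pos.2 hC0) (by norm_num : (1 / 2 : ℝ) < 1)
  have hNpos : 0 < N := by
    rcases Nat.eq_zero_or_pos N with h0 | h0
    · exfalso
      rw [h0, pow_zero] at hN
      have : 1 ≤ C := by
        rw [hC]
        have h4 : (1 : ℝ) ≤ (4 : ℝ) ^ cfDimension A := Real.one_le_rpow (by norm_num) hδ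
        nlinarith [norm_nonneg s, Real.exp_pos (4 * ‖s‖), mul_nonneg (mul_nonneg (by norm_num : (0:ℝ) ≤ 4) (norm_nonneg s)) (Real.exp_pos (4 * ‖s‖)).le]
      have := inv_le_one_of_one_le₀ this
      linarith
    · exact h0
  set K := cfTwK A hA h2 q hs N with hK
  set S := T ^ N - K with hS
  have hSlt : ‖S‖ < 1 := by
    refine (norm_cfTwist_pow_sub_cfTwK_le A hA h2 q hs N).trans_lt ?_
    calc (4 : ℝ) ^ cfDimension A * (1 / 2 : ℝ) ^ N * (2 + 4 * ‖s‖ * Real.exp (4 * ‖s‖)) = C * (1 / 2 : ℝ) ^ N := by rw [hC]; ring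
      _ < C * C⁻¹ := mul_lt_mul_of_pos_left hN hC0
      _ = 1 := mul_inv_cancel₀ hC0.ne'
  have hTN : T ^ N = S + K := by rw [hS, sub_add_cancel]
  obtain ⟨u, hu⟩ := isUnit_one_sub_of_norm_lt_one hSlt
  set R : (SL(2, ZMod q) → CfLip) →L[ℂ] (SL(2, ZMod q) → CfLip) := ↑u⁻¹ with hR
  have hRl : (1 - S) * R = 1 := by rw [← hu, hR, Units.mul_inv]
  have hfac : 1 - T ^ N = (1 - S) * (1 - R * K) := by
    rw [mul_sub, mul_one, ← mul_assoc, hRl, one_mul, hTN]; abel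
  have hfin : FiniteDimensional ℂ (LinearMap.range ((R * K : (SL(2, ZMod q) → CfLip) →L[ℂ] (SL(2, ZMod q) → CfLip)) : (SL(2, ZMod q) → CfLip) →ₗ[ℂ] (SL(2, ZMod q) → CfLip))) := by
    haveI := cfTwK_finiteDimensional A hA h2 q hs N
    have hle : LinearMap.range ((R * K : (SL(2, ZMod q) → CfLip) →L[ℂ] (SL(2, ZMod q) → CfLip)) : (SL(2, ZMod q) → CfLip) →ₗ[ℂ] (SL(2, ZMod q) → CfLip)) ≤
        (LinearMap.range (cfTwK A hA h2 q hs N : (SL(2, ZMod q) → CfLip) →ₗ[ℂ] (SL(2, ZMod q) → CfLip))).map ((R : (SL(2, ZMod q) → CfLip) →L[ℂ] (SL(2, ZMod q) → CfLip)) : (SL(2, ZMod q) → CfLip) →ₗ[ℂ] (SL(2, ZMod q) → CfLip)) := by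
      rintro _ ⟨F, rfl⟩
      exact ⟨cfTwK A hA h2 q hs N F, LinearMap.mem_range_self _ _, rfl⟩
    exact Submodule.finiteDimensional_of_le hle
  have hinj : ∀ x, (R * K) x = x → x = 0 := by
    intro x hx
    by_contra hx0
    have h1 : (1 - R * K) x = 0 := by show x - (R * K) x = 0; rw [hx, sub_self]
    have h2' : (1 - T ^ N) x = 0 := by
      rw [hfac, ContinuousLinearMap.mul_def, ContinuousLinearMap.coe_comp, Function.comp_apply, h1, map_zero]
    have hfix : (T ^ N) x = x := by
      have h3 : x - (T ^ N) x = 0 := h2'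
      exact (sub_eq_zero.1 h3).symm
    obtain ⟨ω, v, hω, hv, heig⟩ := exists_unimodular_eigenvector T hNpos hx0 hfix
    exact hv (cfTwist_eigen_eq_zero A hA h2 q hprim ht hω heig)
  have hunitK := isUnit_one_sub_of_finiteDimensional_range (R * K) hfin hinj
  have hunitN : IsUnit (1 - T ^ N) := by rw [hfac, ← hu]; exact (Units.isUnit u).mul hunitK
  have hgeom : (1 - T) * ∑ i ∈ Finset.range N, T ^ i = 1 - T ^ N := mul_neg_geom_sum T N
  have hcomm : Commute (1 - T) (∑ i ∈ Finset.range N, T ^ i) :=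
    (Commute.sum_right _ _ _ fun i _ => (Commute.one_left T).sub_left (Commute.refl T) |>.pow_right i)
  rw [← hgeom] at hunitN
  exact ((hcomm.isUnit_mul_iff).1 hunitN).1

include h2 in
/-- **Units on the closed half-plane minus `δ`:** for primitive twists, `1 - 𝓜_s` is a unit for every `s`
with `Re s ≥ δ`, `s ≠ δ`. [cite: MageeOhWinter2019, Lemma 15] -/
theorem isUnit_one_sub_cfTwist [NeZero q] {n₀ : ℕ}
    (hprim : ∀ n ≥ n₀, ∀ ξ η : SL(2, ZMod q), ∃ w : List (A × A), w.length = n ∧ ξ * cfSigmaWord A q w = η)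
    {s : ℂ} (hs : cfDimension A ≤ s.re) (hne : s ≠ (cfDimension A : ℂ)) : IsUnit (1 - cfTwist A hA q s) := by
  rcases hs.eq_or_lt with heq | hlt
  · -- boundary: `s = δ + it` with `t = s.im ≠ 0`
    have ht : s.im ≠ 0 := by
      intro h0; apply hne; apply Complex.ext <;> simp [← heq, h0]
    have hsform : s = (cfDimension A : ℂ) + s.im * Complex.I := by
      apply Complex.ext <;> simp [← heq]
    rw [hsform]
    exact isUnit_one_sub_cfTwist_boundary A hA h2 q hprim ht
  · exact (isUnit_one_sub_cfTwist_of_lt A hA h2 q hlt).2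

/-- **Continuity of `s ↦ (1 - 𝓜_s)⁻¹`** wherever `1 - 𝓜_s` is a unit. [folklore] -/
theorem continuousAt_inverse_one_sub_cfTwist [NeZero q] {s : ℂ} (hs : IsUnit (1 - cfTwist A hA q s)) :
    ContinuousAt (fun s => Ring.inverse (1 - cfTwist A hA q s)) s := by
  obtain ⟨u, hu⟩ := hs
  have h1 : ContinuousAt Ring.inverse ((1 : (SL(2, ZMod q) → CfLip) →L[ℂ] _) - cfTwist A hA q s) := by
    rw [← hu]; exact NormedRing.inverse_continuousAt u
  exact ContinuousAt.comp (g := Ring.inverse) h1 (continuous_const.sub (continuous_cfTwist A hA q)).continuousAt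

end HalfPlane

end Literature.NumberTheory.Sieve
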